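import Literature.MathematicalPhysics.QuantumFieldTheory.Balaban1983to89.StepInhabitedMerge
import Literature.MathematicalPhysics.QuantumFieldTheory.Balaban1983to89.B16OverhangN

/-!
# Bałaban's renormalization group for 4-d lattice Yang–Mills — the inductive step, `StepInhabited` PART O.2 (module
# `StepInhabitedMergeIndex`, v1.1): THE OVERHANG BUDGET WIRED — the amortised merger `Budget.controlsAm_merge` (Part N) with its
# geometric binders `hZ`, `hc`, `hover` DISCHARGED BY NAME in the ℤᵈ index model of the operation `S` (cube currency)

CITATION HEADER (lean-in-tree rule 2026-08-18).  Companion to `Step` / `StepInhabited` (same directory, same audit cell `pub-balaban`,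
unit b2b-balaban-f2, FOUNDATIONS 2 — THE INDUCTIVE STEP; react-only addition of f2 gen 19, DOCFIX v1.1 by f2 gen 20), and like them a TYPED SKELETON with
kernel-checked bookkeeping, here of ONE passage of the published series: T. Bałaban, *Large field renormalization. II. Localization,
exponentiation, and bounds for the 𝐑 operation*, Commun. Math. Phys. **122**, 355–392 (1989) [Balaban1989LargeFieldII] (cell paper B16;
held `paper:balaban1989-cmp122-large-field-ii`, journal page = PDF page + 354), CASE 2 of the auxiliary induction pp. 386–387 [PDF 32–33],
(1.85)–(1.88), with the weights of (1.80) p. 384 and the flow inequality (2.9) of *Convergent renormalization expansions for lattice gauge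
theories*, Commun. Math. Phys. **119**, 243–285 (1988) [Balaban1988Convergent] p. 256.  The passage adjudicated (renders
`b2b-balaban-ref1/pages/1989-cmp122-large-field-II/1989-cmp122-large-field-II-p032-x2.png`, `…-p033-x2.png`, read as images by the typists
of `Step` Part F, `…B16Absorption` and `…B16Overhang` v1.1, whose headers quote it in full): (1.85) p. 386, *"κ_{j+1}(Z) =
Σ_n(κ_j(Z_j^{(n)}) + 2p₀(g_{j(Z_j^{(n)})})) + Σ_i(γ₀A₁²p₀²(g_{j+1})(d′_{j+1}(Z_{j+1}^{(i)}) + 1) + 2p₀(g_{j+1})) −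
O(1)M^dR_{j+1}^{d+1}d′_{j+1}(Z) − 2p₀(g_{j(Z)})"* (`Step.Budget.merge`); p. 387 ll. 8–16, *"The domain S^{K₁}(X) satisfies the conditions
(i), (ii), in particular it is contained in a cube of the size 100MR_{j+1+K₁}, and it intersects the domains S^{K₁}(Y). It is clear that
applying n₁ times the operation S to the last domain, where n₁ is a rather small number, e.g., n₁ < 10, we obtain the domain S^{K₁+n₁}(Y)
containing S^{K₁+n₁}(X). This implies that S^{n−j−1}(Z) = S^{n−j−1}(Y) for n ≧ j + 1 + K₁ + n₁, and that K ≦ K₂ + n₁ + R_{j+1}. To prove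
the statement for κ_{j+1}(Z) we estimate the sum in (1.80): Σ_{n=j+2}^{j+1+K} O(1)M^dR^{d+1}_{j+1}d′_n(S^{n−j−1}(Z)) ≦
Σ_{n=j+2}^{j+1+K₁+n₁} O(1)M^dR^{d+1}_{j+1}d′_n(S^{n−j−1}(X)) + Σ_{n=j+2}^{j+1+K₂+n₁+R_{j+1}} O(1)M^dR^{d+1}_{j+1}d′_n(S^{n−j−1}(Y)) ≦
κ_{j+1}(X) + κ_{j+1}(Y) + O(1)2(100M)^dR^{d+2}_{j+1} ≦ κ_{j+1}(Z) − 2(1 + β₀)^{−1}p₀(g_{j+1}) + O(1)3(100M)^dR^{d+2}_{j+1} ≦ κ_{j+1}(Z),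
(1.88) for p₀ large and γ small enough."*; and (2.9) p. 256 of [Balaban1988Convergent], first member, *"R_n ≦ LR_m"* (render
`b2b-balaban-ref1/pages/1988-cmp119-convergent-renormalization/1988-cmp119-convergent-renormalization-p014-x2.png`, read as an image by f2
gen 20; stated for the indices of (2.6) p. 255, *"where n > m"*) — used along the flow in the cell's instance `m = j`, written `R_n ≤ LR_j`
OUTSIDE quotation marks in `Step` Part F / `StepInhabited` Part L (typed in raw-sequence form as `Step.Budget.RStepLe`).  B16 is a manuscript
UNDER ADJUDICATION by the audit cell: NOTHING printed in it is asserted here.  Every declaration below is a `theorem` of elementary real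
arithmetic / finite-sum bookkeeping, proved without `sorry` and without new axioms (`#print axioms` ⊆ {propext, Classical.choice,
Quot.sound}), over the EXISTING definitions
`Step.Budget.{Consts, Consts.cost, Controls, merge}` (`Step` Part F), `Step.Budget.{ControlsAm, RStepLe}` (`StepInhabited` Parts N, L),
`B13ScaleTransfer.Pt`, `B16SProfile.{Siter, Sop, ratio, DropCtl}`, `B16MergeGeometry.TouchConnected`, `B16StoppingRule.CondI`,
`TreeLength.treeLen`, `B16OverhangN.overhangN`, using BY NAME `Step.Budget.controlsAm_merge`, Part O.1's `Step.Budget.hover_of_amortised`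
(module `StepInhabitedMerge`), `Step.Budget.ControlsAm.controls`, `Step.Budget.Consts.{cost_sum, cost_mono, cost_nonneg}` and the b02
lineage's `B16OverhangN.{card_Siter_le_alive_add_overhangN, sum_overhangN_amortised_touch}`, `B16SProfile.Siter_zero`.  There is NO `def`:
no notion is introduced.  VALUE = typed skeleton + gap census (the cell's `STEP.md` §11 row O-F4: the COST half of case 2 CLOSED BY NAME
in the index model, cube currency), NOT summit progress.  Prose companion: the cell's `STEP.md` (v11.11 / v11.12: §7.11–§7.13, §11 O-F4;
`GAPS.md` C-f2.25 / C-f2.26; `DIVERGENCE.md` D-f2.22).  Staged byte-identically in the cell package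
`run/shared/lean/pub/pub-balaban/lean/BalabanYm4/Literature/…`.

VERSION.  v1 (f2 gen 19) = the staged file `run/shared/lean/pub/pub-balaban/b2b-balaban-f2-g19/StepInhabitedMergeIndex.v1.lean` (sha256[:16]
0dd3f9a3470895b0), cross-read BEFORE landing (the cell's `GAPS.md` C-pv14-62: ok-with-objection, kernel re-run on a concatenation twin) and never
in the tree, because its import `…B16OverhangN` was not yet applied.  v1.1 (f2 gen 20) = the version landed in the tree: the five theorem STATEMENTS AND
PROOFS are byte-identical to v1; header and docstrings carry the DOCFIX of that cross-read — O1 (the exponent terms of `controlsAm_merge_index`: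
`Pp x = 2p₀(g_{j(x)})`, `PZ = 2p₀(g_{j(Z)})`, the factor (1+β₀)⁻¹ belongs to `q` only), O2 (the quotation of (2.9) above, print's *"R_n ≦ LR_m"*),
and the records-only remarks R1 (locus p. 386–387 in `hc_index`), R2 (`h29`, `hD` named in the HYPOTHESES sentence), R3 (NOT-PRINTED clause next
to the locator tag of `controls_merge_index`), R4 (the two dimension parameters, paragraph (a) below).

WHY A SEPARATE LEAF MODULE (see also Part O.1's header).  `StepInhabited` imports `Step` only, so that every importer of `Step` can import
it without cycles; the b02 lineage's index-model modules `B16SProfile` → `B16MergeGeometry` / `B16Absorption` / `B16StoppingRule` →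
`B16MergeHorizon` → `B16Overhang` → `B16OverhangN` import `StepInhabited`.  The wiring below CONSUMES `B16OverhangN`, hence cannot be
appended to `StepInhabited` (import cycle) nor to `Step` (frozen at the gate's 200 000-byte cap since v7.1); it opens this leaf module,
which imports `…StepInhabitedMerge` (Part O.1) and `…B16OverhangN` and modifies nothing.  Declarations keep the namespace
`…Balaban1983to89.Step.Budget` (one vocabulary: `Budget.controlsAm_merge_index` next to `Budget.controlsAm_merge`).

WHAT PRINT DOES / WHAT THE CELL FOUND / WHAT PART N TYPED — see the docblock of `StepInhabited` Part N: print obtains (1.80) for a merged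
component from (1.85)–(1.86), the inductive assumptions and the sub-additivity (1.88) of the (1.80)-sums with a UNIFORM remainder, resting
on the absorption sentence of p. 387 ll. 12–15; the b02 lineage refuted that sentence in the ℤᵈ index model `S = collar^[10] ∘ closureIdx`
(`B16Absorption.no_uniform_absorption`, `sum_card_defect`); Part N typed the cell's substitute — NOT PRINTED — an AMORTISED (1.80) with a
multiplicative reserve `θ` (`Budget.ControlsAm`), re-established at an `N`-ary merger (`Budget.controlsAm_merge`) from the printed
exponent gain and cost sub-additivity summed over the merging family plus ONE new geometric hypothesis, the OVERHANG BUDGET `hover` (`Σ_n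
cost_n(o_n) ≤ η·Σ_x cost_{j+1}(size x) + (|S|−1)·Fee`, `(1+θ)η ≤ θ`), next to the live/dead decomposition `hZ` and the cost sub-additivity
`hc`.  WHAT THE b02 LINEAGE THEN PROVED (units b02 gen 11, modules `B16Overhang`, `B16OverhangN`; kernel, index model, CUBE currency —
sizes = numbers of cubes of the iterates, unit weights): the dead overhang profile `o_m = overhangN q S B a m` (the cubes of `S^m(Z)`
outside the iterate of the union of the pieces alive at step `m`) satisfies `hZ` pointwise (`card_Siter_le_alive_add_overhangN`) and,
summed over any horizon `K ≤ N + T` with `2^T ≤ 2(2·treeLen S(Z) + 1)` (the duration–size link `two_pow_find_sub_le₁` of the least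
stopping index with memory `N = R_{j+1}`), the AMORTISED bound `Σ_{0<m≤K} o_m ≤ |S|·561^d·j′ + 1122^d·(N+k) + 1122^d·21^d·(2(k+2)/2^k +
16/2^{j′})·Σ_x #B_x` for every `j′, k` (`sum_overhangN_amortised_touch`, for a TOUCH-connected merger whose members dying before `K`
satisfy condition (i) when they die) — slope as small as desired, fee per piece and per scale of the horizon: (G-AMORT) INHABITED for
every `η > 0`.

WHAT IS TYPED — OURS, NOT BAŁABAN'S (every declaration is labelled accordingly in its docstring).  (O.1, module `StepInhabitedMerge`) The
weights of (2.9a) along a merged horizon — `cost_n(s) ≤ L^{d+1}·cost_{j+1}(s)` for `j+1 < n ≤ K_h` under `RStepLe R L K_h`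
(`cost_le_pow_mul_cost_succ`, `sum_cost_le_pow_mul_cost_sum`; print's (1.88) has the constant weight `O(1)M^dR^{d+1}_{j+1}` outright, the
typed (1.80) = `Budget.Controls` carries `R_n`) — and the ABSTRACT amortisation arithmetic `hover_of_amortised`: an unweighted amortised
bound of b02's shape `Σ_{0<m≤K_Z} o_m ≤ A·|S| + B + c·Σ_x sz x` with `L^{d+1}·c ≤ η` yields `hover` with the EXPLICIT fee `Fee =
L^{d+1}·cost_{j+1}(2A + B)` for `|S| ≥ 2`; `exists_slope_params`: every `η > 0` is served by some `j′, k`.  (O.2, HERE) The three binders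
of `controlsAm_merge` DISCHARGED in the index model under the dictionary «time 0 = the merge scale `j+1`; piece `x` has body `B x ⊆ ℤᵈ` at
scale `j+1`, death step `a x` (horizon `K_x = a x + 1` from scale `j`), size profile `n ↦ #S^{n−j−1}(B x)`; `Z = ⋃_x B x` has profile `n ↦
#S^{n−j−1}(Z)`; `o_n = overhangN(n−j−1)`»: `hZ_index` (b02's pointwise bound re-indexed), `hc_index` (FREE in cube currency: `#Z ≤ Σ_x
#B_x`, any `D ≥ 0`), `hover_index` (b02's amortised bound through O.1, `Fee = L^{d+1}·cost_{j+1}(2·561^d·j′ + 1122^d·(N+k))`), and the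
END-TO-END statements `controlsAm_merge_index` (the amortised (1.80) at scale `j+1` for the merged component, `κ_{j+1}(Z)` given by
(1.85)) and `controls_merge_index` ((1.80) itself, the reserve dropped) — modulo the NON-geometric inputs of Part N only: the amortised
statement for every piece at scale `j` (the induction hypothesis / the bracket of a new region), condition (i) at the deaths, the horizon
clauses, the summed exponent gain (F5), the reserve bookkeeping `(1+θ)η ≤ θ` with the slope clause, and ONE located smallness condition
`(1+θ)·Fee + D ≤ 2(1+β₀)⁻¹p₀(g_{j+1})` in place of print's «for p₀ large and γ small enough».

WHAT IS NOT TYPED AND NOT CLAIMED.  (a) CURRENCY: everything here is in CUBE currency (sizes = cube counts `#S^m(·)`), b02's currency for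
the merge chain; the typed base case of the induction (`StepInhabited` Part M with `B16SProfile.majorant_181_of_B14`) is in TREE-LENGTH
currency (`d′ = treeLen`, print's).  The two are equivalent up to dimensional constants on face-connected families
(`TreeLength.treeLen_le_card_sub_one`: `treeLen Y ≤ #Y − 1`; `TreeLength.card_le_treeLen`: `#Y ≤ 2^d(4·treeLen Y + 1)`), and the cost is
monotone in the size, so (1.80) in cube currency implies (1.80) in tree-length currency with the same budget — but the INDUCTION `j → j+1`
is not closed across the two currencies in this module (the induction hypothesis `hpiece` is demanded in cube currency): the cell's
`DIVERGENCE.md` D-f2.22, `STEP.md` §9.  Two DIMENSION parameters occur independently in the statements below and are NOT identified: the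
cost exponent's `b.d` of `Step.Budget.Consts` (weights `O(1)M^dR_n^{d+1}`, the factor `L^{b.d+1}` of `hslope` / `Fee`) and the index-model
dimension `d` of `Pt d = ℤᵈ` (the constants `561^d`, `1122^d`, `21^d`); the intended reading is `b.d = d` (= 4), but no statement needs
it.  (b) The identification of the index model (`B16SProfile`: `S = collar^[10] ∘ closureIdx` on ℤᵈ with the flow `ratio L σ`) with
print's domains and operation `S` (the cell's D-b02g9.1), and of `DropCtl` with the second member of
(2.9). (c) That Bałaban's proof intends any amortised bookkeeping — it prints none (D-f2.21); the printed route (uniform remainder) stays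
typed as `Step` Part F (`merge_controls`, binder `hsub`), correct over its binders and uninhabitable along the printed sentence in the
model. (d) The located smallness condition CHANGES relative to print: `Fee` carries `L^{d+1}` (weights via (2.9a) only) and the constants
`2·561^d·j′ + 1122^d·(N+k)` of the index model where print has `O(1)2(100M)^dR^{d+2}_{j+1}`; with `N = R_{j+1}` and `j′, k =
O(log(L^{d+1}/η))` the SHAPE `O_d(1)·L^{d+1}·M^dR_{j+1}^{d+2}` is print's up to the constant — the cell's `SMALLNESS.md` (owner r2)
records the located row. (e) Summit progress: none — typed skeleton and kernel bookkeeping over the b02 lineage's combinatorics.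
-/


namespace Literature.MathematicalPhysics.QuantumFieldTheory.Balaban1983to89.Step

open Literature.MathematicalPhysics.QuantumFieldTheory.Balaban1983to89
open Literature.MathematicalPhysics.QuantumFieldTheory.Balaban1983to89.B13ScaleTransfer
open Literature.MathematicalPhysics.QuantumFieldTheory.Balaban1983to89.B16SProfile
open Literature.MathematicalPhysics.QuantumFieldTheory.Balaban1983to89.B16MergeGeometry
open Literature.MathematicalPhysics.QuantumFieldTheory.Balaban1983to89.B16StoppingRule
open Literature.MathematicalPhysics.QuantumFieldTheory.Balaban1983to89.B16OverhangN
open Literature.MathematicalPhysics.QuantumFieldTheory.Balaban1983to89.TreeLength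

namespace Budget

/-! ### O.2: the binders `hZ`, `hc`, `hover` of `controlsAm_merge` DISCHARGED in the ℤᵈ index model of `S` (unit b02's
`B16SProfile` / `B16OverhangN`), cube currency, and the end-to-end statement -/

section IndexModel

variable {d : ℕ} {ι : Type*}

/-- THE BINDER `hZ` OF `controlsAm_merge` IN THE INDEX MODEL (cube currency).  DICTIONARY (time `0` = the merge scale `j+1`): the
pieces' bodies `B x ⊆ ℤᵈ` at scale `j+1`, their death steps `a x` (piece `x` alive at step `m` iff `m ≤ a x`, i.e. its horizon from
scale `j` is `K_x = a x + 1`), the flow `q`, the size profiles `n ↦ #S^{n−j−1}(B x)` and `n ↦ #S^{n−j−1}(Z)` of `Z = ⋃_{x∈S} B x`, and the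
overhang profile `n ↦ o_{n−j−1}` of `B16OverhangN.overhangN`: `#S^{n−j−1}(Z) ≤ Σ_{x alive at n} #S^{n−j−1}(B x) + o_{n−j−1}` at every
scale `n` of the merged horizon — b02's `B16OverhangN.card_Siter_le_alive_add_overhangN`, re-indexed.  Cell bookkeeping, NOT a printed
statement (print asserts no overhang, p.387). [folklore] -/
theorem hZ_index (q : ℕ → ℕ) (S : Finset ι) (B : ι → Finset (Pt d)) (a : ι → ℕ) (j KZ : ℕ) :
    ∀ n ∈ Finset.Ioc (j + 1) (j + 1 + KZ),
      ((Siter q (n - (j + 1)) (S.biUnion B)).card : ℝ) ≤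
        (∑ x ∈ S.filter (fun x => n ≤ j + (a x + 1)), ((Siter q (n - (j + 1)) (B x)).card : ℝ))
          + (overhangN q S B a (n - (j + 1)) : ℝ) := by
  intro n _
  have h := card_Siter_le_alive_add_overhangN q S B a (n - (j + 1))
  have hfilter : S.filter (fun x => n ≤ j + (a x + 1)) = S.filter (fun x => n - (j + 1) ≤ a x) :=
    Finset.filter_congr fun x _ => ⟨fun h => by omega, fun h => by omega⟩
  rw [hfilter]
  exact_mod_cast h

/-- THE BINDER `hc` OF `controlsAm_merge` IS FREE IN CUBE CURRENCY: `#Z ≤ Σ_x #B x` (`Finset.card_biUnion_le`), hence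
`cost_{j+1}(#Z) ≤ Σ_x cost_{j+1}(#B x) + (|S|−1)·D` for every `D ≥ 0` (in tree-length currency the printed «d′_{j+1}(X) + d′_{j+1}(Y) +
2d ≧ d′_{j+1}(Z)», the last display of p.386, its sentence closing on p.387, needs the gluing constant — b02's
`B16MergeGeometry.treeLen_fam_le`; for cube counts sub-additivity of the cardinality suffices).  Cell bookkeeping. [folklore] -/
theorem hc_index (b : Consts) (q : ℕ → ℕ) (S : Finset ι) (hS : S.Nonempty) (B : ι → Finset (Pt d)) (j : ℕ) (D : ℝ)
    (hD : 0 ≤ D) (hC : 0 ≤ b.C) (hM : 0 ≤ b.M) (hR : ∀ n, 0 ≤ b.R n) :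
    b.cost (j + 1) ((Siter q ((j + 1) - (j + 1)) (S.biUnion B)).card : ℝ) ≤
      (∑ x ∈ S, b.cost (j + 1) ((Siter q ((j + 1) - (j + 1)) (B x)).card : ℝ)) + ((S.card : ℝ) - 1) * D := by
  simp only [Nat.sub_self, Siter_zero]
  have h1 : ((S.biUnion B).card : ℝ) ≤ ∑ x ∈ S, ((B x).card : ℝ) := by
    exact_mod_cast Finset.card_biUnion_le
  have h2 : b.cost (j + 1) ((S.biUnion B).card : ℝ) ≤ b.cost (j + 1) (∑ x ∈ S, ((B x).card : ℝ)) :=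
    b.cost_mono (j + 1) hC hM (hR (j + 1)) h1
  rw [Consts.cost_sum] at h2
  have hm : (0 : ℝ) ≤ (S.card : ℝ) - 1 := by
    have h3 : 1 ≤ S.card := Finset.card_pos.mpr hS
    have h4 : (1 : ℝ) ≤ (S.card : ℝ) := by exact_mod_cast h3
    linarith
  have h3 := mul_nonneg hm hD
  linarith

/-- THE OVERHANG BUDGET `hover` OF `controlsAm_merge` — (G-AMORT) of the cell's `STEP.md` §7.11 (4) — DISCHARGED in the index model, cube
currency, by b02's `B16OverhangN.sum_overhangN_amortised_touch` and the weights of (2.9a) (`hover_of_amortised`): for a TOUCH-connected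
merger `Z = ⋃_{x∈S} B x` of `|S| ≥ 2` pieces with chosen cubes `bx x ∈ B x`, whose members dying before the merged horizon `K_Z` satisfy
condition (i) at their death step (`hI`), under the flow `ratio L σ`, `L ≥ 4`, with drop control up to `m′ ≥ K_Z` (`hσ`, `hKm`; unit b02's
typed content of the second member of (2.9) [Balaban1988Convergent] p.256), the merged horizon inside the (2.9a)-horizon (`h29`, `hKh`), the
duration–size link `K_Z ≤ N + T`, `2^T ≤ 2(2·treeLen S(Z) + 1)` (`hKT`, `hT`; b02's `B16OverhangN.two_pow_find_sub_le₁` for the least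
stopping index with memory `N = R_{j+1}`), and slope parameters `j′, k` with `L^{d+1}·1122^d·21^d·(2(k+2)/2^k + 16/2^{j′}) ≤ η` (`hslope`;
every `η > 0` is served, `exists_slope_params`):
`Σ_{n=j+2}^{j+1+K_Z} cost_n(o_{n−j−1}) ≤ η·Σ_x cost_{j+1}(#B x) + (|S|−1)·Fee`, `Fee = L^{d+1}·cost_{j+1}(2·561^d·j′ + 1122^d·(N+k))` —
of order `L^{d+1}·O(1)M^dR_{j+1}^{d+1}·(R_{j+1} + k + j′)·O_d(1)`, the SHAPE of print's remainder `O(1)2(100M)^dR^{d+2}_{j+1}` in (1.88) p.387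
up to the constant.  NOT a printed statement: kernel-checked arithmetic over b02's theorem. [folklore] -/
theorem hover_index (b : Consts) (S : Finset ι) (h2 : 2 ≤ S.card) {L : ℕ} (hL : 4 ≤ L) {σ : ℕ → ℕ} {m' : ℕ}
    (hσ : DropCtl σ m') (B : ι → Finset (Pt d)) {bx : ι → Pt d} (hb : ∀ x ∈ S, bx x ∈ B x) (a : ι → ℕ)
    (hZc : TouchConnected (S.biUnion B)) (η : ℝ) (j KZ Kh N T jf k : ℕ)
    (hC : 0 ≤ b.C) (hM : 0 ≤ b.M) (hR : ∀ n, 0 ≤ b.R n) (h29 : RStepLe b.R L Kh) (hKh : j + 1 + KZ ≤ Kh)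
    (hI : ∀ x ∈ S, a x < KZ → CondI 100 (Siter (ratio L σ) (a x) (B x)))
    (hKm : KZ ≤ m') (hKT : KZ ≤ N + T)
    (hT : (2 : ℝ) ^ T ≤ 2 * (2 * treeLen (Sop (ratio L σ 0) (S.biUnion B)) + 1))
    (hslope : (L : ℝ) ^ (b.d + 1) * (1122 ^ d * 21 ^ d * (2 * ((k + 2) / 2 ^ k) + 16 / 2 ^ jf)) ≤ η) :
    ∑ n ∈ Finset.Ioc (j + 1) (j + 1 + KZ), b.cost n (overhangN (ratio L σ) S B a (n - (j + 1)) : ℝ) ≤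
      η * (∑ x ∈ S, b.cost (j + 1) ((Siter (ratio L σ) ((j + 1) - (j + 1)) (B x)).card : ℝ))
        + ((S.card : ℝ) - 1) * ((L : ℝ) ^ (b.d + 1) * b.cost (j + 1) (2 * (561 ^ d * jf) + 1122 ^ d * (N + k))) := by
  have hS : S.Nonempty := Finset.card_pos.mp (by omega)
  simp only [Nat.sub_self, Siter_zero]
  have hgeo := sum_overhangN_amortised_touch hL hσ hb hI hS hZc hKm hKT hT jf k
  rw [Nat.cast_sum] at hgeo
  have hsum : ∑ m ∈ Finset.Ioc 0 KZ, (overhangN (ratio L σ) S B a m : ℝ) ≤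
      561 ^ d * jf * S.card + 1122 ^ d * (N + k)
        + 1122 ^ d * 21 ^ d * (2 * ((k + 2) / 2 ^ k) + 16 / 2 ^ jf) * ∑ x ∈ S, ((B x).card : ℝ) := by
    linarith [hgeo]
  exact hover_of_amortised b S h2 h29 hKh hC hM hR (Nat.cast_nonneg L)
    (fun m => (overhangN (ratio L σ) S B a m : ℝ)) (fun m => Nat.cast_nonneg _)
    (fun x => ((B x).card : ℝ)) (fun x _ => Nat.cast_nonneg _)
    (by positivity) (by positivity) hsum hslope

/-- THE AMORTISED STATEMENT (1.80)×(1+θ) AT SCALE `j+1` FOR A MERGED COMPONENT, IN THE INDEX MODEL, END TO END MODULO ITS NON-GEOMETRIC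
INPUTS: `controlsAm_merge` (Part N) WITH `hZ`, `hc`, `hover` DISCHARGED (`hZ_index`, `hc_index`, `hover_index`).  Cube currency; NOT
PRINTED — the cell's substitute for case 2 of the auxiliary induction of [Balaban1989LargeFieldII] pp.386–387, whose printed route rests
on the absorption sentence of p.387 refuted in this model (`B16Absorption.no_uniform_absorption`, unit b02).  DATA: a family `S` of
`|S| ≥ 2` pieces with bodies `B x ⊆ ℤᵈ` at the merge scale `j+1` (old components: their first `S`-iterate; new regions: themselves) whose
union `Z = ⋃ B x` is touch-connected (`hZc`; the graph G of p.386), a cube `bx x ∈ B x` per piece, death steps `a x` (horizon `K_x = a x + 1`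
from scale `j`), the flow `ratio L σ` with `L ≥ 4` and drop control on `[0, m′]`; budgets `κ x` (before the scale-`(j+1)` cost) and exponent
terms `Pp x = 2p₀(g_{j(x)})`, `PZ = 2p₀(g_{j(Z)})` (as in (1.85) and in Part N's `controlsAm_merge`; the factor `(1+β₀)⁻¹` belongs to
`q = 2(1+β₀)⁻¹p₀(g_{j+1})` only — p.386, *"2p₀(g_{j(X)}) + 2p₀(g_{j(Y)}) − 2p₀(g_{j(Z)}) ≧ 2(1 + β₀)^{−1}p₀(g_{j+1})"*).  HYPOTHESES:
every piece satisfies the amortised statement at scale `j` in cube currency with horizon `K_x` (`hpiece` — the induction hypothesis, resp.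
the bracket of a new region); the pieces dying before `K_Z` satisfy (i) when they die (`hI` — the definition of their horizons, p.384);
the horizon clauses `hKm`, `hKh`, `hKT`, `hT`; (2.9a) up to a horizon `Kh ≥ j+1+K_Z` (`h29 : RStepLe b.R L Kh`, consumed through
`hover_index` / Part O.1); the summed exponent gain `hP`
(`sum_P_ge_of_binary` with F5 `hP_of_logPowMono`, from (2.7a)); the reserve bookkeeping `(1+θ)η ≤ θ` with the slope clause `hslope`; the sign
clauses `hθ`, `hC`, `hM`, `hR`, `hD : 0 ≤ D`; and ONE located smallness condition `hbudget : (1+θ)·Fee + D ≤ q` (print's «for p₀ large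
and γ small», with `q = 2(1+β₀)⁻¹p₀(g_{j+1})`, `Fee = L^{d+1}·cost_{j+1}(2·561^d·j′ + 1122^d·(N+k))`, any `D ≥ 0`).  CONCLUSION: the
budget `κ_{j+1}(Z)` of (1.85) (`merge`) controls `K_Z` steps of `Z`'s cube-count profile with the reserve `θ` — whence (1.80) at scale
`j+1` for `Z` in cube
currency (`ControlsAm.controls`) and, the cost being monotone in the size, in tree-length currency (`TreeLength.treeLen_le_card_sub_one`).
Nothing printed in B14/B16 is asserted. [folklore] -/
theorem controlsAm_merge_index (b : Consts) (S : Finset ι) (h2 : 2 ≤ S.card) {L : ℕ} (hL : 4 ≤ L) {σ : ℕ → ℕ}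
    {m' : ℕ} (hσ : DropCtl σ m') (B : ι → Finset (Pt d)) {bx : ι → Pt d} (hb : ∀ x ∈ S, bx x ∈ B x) (a : ι → ℕ)
    (hZc : TouchConnected (S.biUnion B)) (θ η q D : ℝ) (j KZ Kh N T jf k : ℕ) (κ Pp : ι → ℝ) (PZ : ℝ)
    (hθ : 0 ≤ θ) (hη : (1 + θ) * η ≤ θ) (hC : 0 ≤ b.C) (hM : 0 ≤ b.M) (hR : ∀ n, 0 ≤ b.R n) (hD : 0 ≤ D)
    (h29 : RStepLe b.R L Kh) (hKh : j + 1 + KZ ≤ Kh)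
    (hI : ∀ x ∈ S, a x < KZ → CondI 100 (Siter (ratio L σ) (a x) (B x)))
    (hKm : KZ ≤ m') (hKT : KZ ≤ N + T)
    (hT : (2 : ℝ) ^ T ≤ 2 * (2 * treeLen (Sop (ratio L σ 0) (S.biUnion B)) + 1))
    (hslope : (L : ℝ) ^ (b.d + 1) * (1122 ^ d * 21 ^ d * (2 * ((k + 2) / 2 ^ k) + 16 / 2 ^ jf)) ≤ η)
    (hpiece : ∀ x ∈ S, ControlsAm b θ j (a x + 1) (κ x)
      (fun n => ((Siter (ratio L σ) (n - (j + 1)) (B x)).card : ℝ)))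
    (hP : ((S.card : ℝ) - 1) * q ≤ (∑ x ∈ S, Pp x) - PZ)
    (hbudget : (1 + θ) * ((L : ℝ) ^ (b.d + 1) * b.cost (j + 1) (2 * (561 ^ d * jf) + 1122 ^ d * (N + k))) + D ≤ q) :
    ControlsAm b θ (j + 1) KZ
      (merge (fun x => κ x + Pp x) S (b.cost (j + 1) ((S.biUnion B).card : ℝ)) PZ)
      (fun n => ((Siter (ratio L σ) (n - (j + 1)) (S.biUnion B)).card : ℝ)) := by
  have hS : S.Nonempty := Finset.card_pos.mp (by omega)
  have h := controlsAm_merge b S hS θ η q D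
    ((L : ℝ) ^ (b.d + 1) * b.cost (j + 1) (2 * (561 ^ d * jf) + 1122 ^ d * (N + k)))
    j KZ (fun x => a x + 1) κ Pp PZ
    (fun x n => ((Siter (ratio L σ) (n - (j + 1)) (B x)).card : ℝ))
    (fun n => ((Siter (ratio L σ) (n - (j + 1)) (S.biUnion B)).card : ℝ))
    (fun n => (overhangN (ratio L σ) S B a (n - (j + 1)) : ℝ))
    hθ hη hC hM hR (fun x _ n => Nat.cast_nonneg _)
    (fun x hx => ⟨Nat.le_add_left 1 (a x), hpiece x hx⟩) hP
    (hc_index b (ratio L σ) S hS B j D hD hC hM hR)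
    (hZ_index (ratio L σ) S B a j KZ)
    (hover_index b S h2 hL hσ B hb a hZc η j KZ Kh N T jf k hC hM hR h29 hKh hI hKm hKT hT hslope)
    hbudget
  simpa only [Nat.sub_self, Siter_zero] using h

/-- (1.80) ITSELF AT SCALE `j+1` FOR THE MERGED COMPONENT, cube currency, index model: the reserve dropped (`ControlsAm.controls`).
NOT PRINTED as a route — the cell's substitute over the amortised statement for the pieces, the overhang budget and ONE located smallness row
(see `controlsAm_merge_index`); the tag below LOCATES THE SHAPE of the conclusion, (1.80) p.384, on a kernel-proved theorem and imports
nothing printed as a hypothesis. [cite: Balaban1989LargeFieldII, (1.80) p.384] -/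
theorem controls_merge_index (b : Consts) (S : Finset ι) (h2 : 2 ≤ S.card) {L : ℕ} (hL : 4 ≤ L) {σ : ℕ → ℕ}
    {m' : ℕ} (hσ : DropCtl σ m') (B : ι → Finset (Pt d)) {bx : ι → Pt d} (hb : ∀ x ∈ S, bx x ∈ B x) (a : ι → ℕ)
    (hZc : TouchConnected (S.biUnion B)) (θ η q D : ℝ) (j KZ Kh N T jf k : ℕ) (κ Pp : ι → ℝ) (PZ : ℝ)
    (hθ : 0 ≤ θ) (hη : (1 + θ) * η ≤ θ) (hC : 0 ≤ b.C) (hM : 0 ≤ b.M) (hR : ∀ n, 0 ≤ b.R n) (hD : 0 ≤ D)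
    (h29 : RStepLe b.R L Kh) (hKh : j + 1 + KZ ≤ Kh)
    (hI : ∀ x ∈ S, a x < KZ → CondI 100 (Siter (ratio L σ) (a x) (B x)))
    (hKm : KZ ≤ m') (hKT : KZ ≤ N + T)
    (hT : (2 : ℝ) ^ T ≤ 2 * (2 * treeLen (Sop (ratio L σ 0) (S.biUnion B)) + 1))
    (hslope : (L : ℝ) ^ (b.d + 1) * (1122 ^ d * 21 ^ d * (2 * ((k + 2) / 2 ^ k) + 16 / 2 ^ jf)) ≤ η)
    (hpiece : ∀ x ∈ S, ControlsAm b θ j (a x + 1) (κ x)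
      (fun n => ((Siter (ratio L σ) (n - (j + 1)) (B x)).card : ℝ)))
    (hP : ((S.card : ℝ) - 1) * q ≤ (∑ x ∈ S, Pp x) - PZ)
    (hbudget : (1 + θ) * ((L : ℝ) ^ (b.d + 1) * b.cost (j + 1) (2 * (561 ^ d * jf) + 1122 ^ d * (N + k))) + D ≤ q) :
    Controls b (j + 1) KZ
      (merge (fun x => κ x + Pp x) S (b.cost (j + 1) ((S.biUnion B).card : ℝ)) PZ)
      (fun n => ((Siter (ratio L σ) (n - (j + 1)) (S.biUnion B)).card : ℝ)) :=
  (controlsAm_merge_index b S h2 hL hσ B hb a hZc θ η q D j KZ Kh N T jf k κ Pp PZ hθ hη hC hM hR hD h29 hKh hI hKm hKT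
    hT hslope hpiece hP hbudget).controls hθ
    (Finset.sum_nonneg fun n _ => b.cost_nonneg n hC hM (hR n) (Nat.cast_nonneg _))

end IndexModel

end Budget

end Literature.MathematicalPhysics.QuantumFieldTheory.Balaban1983to89.Step
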